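import Mathlib
import HarnessLib.Audit
import Summits.PneNP.PneNP.Theorems.PstarGapCluster
import Summits.PneNP.PneNP.Theorems.PstarGapTwo

/-!
# Killed reader stars: the mixed pin rung is multiplicative (ROUND-24, calibration of T24.21 `MixedPinGap`)

FRONTIER range-avoidance ladder, rung F-N3, ROUND 24 (cell `pnp-ideate`; restricted-model proof complexity — nothing here bears
on `P` versus `NP`).

The planner's T24.21 (`PstarGapTwo.MixedPinGap`): unit pins `W` plus ONE parity `w` `⇒ |J| ≤ K₁(Δ)·(|W| + 1)`.  Its docstring records
that the ADDITIVE form `2|W| + K₁(Δ)` is false; this file PROVES the calibration: for all `Δ ≥ 1` and `h`, there is a pure typed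
instance with simple overlaps, maximum degree `Δ`, boundary-expanding for every radius, with `h` unit pins (KILLS `a_{q_k} = 0` at the
centres of `h` disjoint reader stars) and one parity (the sum of all tips) making the `h·Δ` readers minimal infeasible
(`exists_killed_stars`).  Hence any constant `K` valid in `MixedPinGap` at degree `Δ` satisfies `Δ·h ≤ K·(h + 1)` for every `h`
(`mixedPinGap_const_ge`) — one paid parity cashes every pin at rate `Δ`, so `K₁(Δ) ≥ Δ·h/(h+1)`, i.e. `K₁(Δ) ≥ Δ - 1`.
Construction = the graph instance `PstarGraphQuadGapInstance.inst` of `h` disjoint stars `K_{1,Δ}` with the graph-quadratic system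
{`Σ_E a_p a_q = 1`} ∪ {`a_{q_k} = 0`} (unsat: the pins kill every monomial; edge-minimal: the all-`false` assignment), lifted by
`PstarGraphQuadGapReduction.minInfeasible_univ`.
-/

set_option linter.dupNamespace false

open Finset Literature.Computability.Complexity
open Summit.PneNP.PneNP.Theorems.PstarPDT (parity)
open Summit.PneNP.PneNP.Theorems.PstarTyped (Typed)
open Summit.PneNP.PneNP.Theorems.PstarSALevel (varSet BoundaryExpanding SimpleOverlap)
open Summit.PneNP.PneNP.Theorems.PstarGapLemma (MinInfeasible MaxDegree)
open Summit.PneNP.PneNP.Theorems.PstarGraphQuadGap (Edge QCon qval QHolds Simple EdgeMaxDegree Supported Unsat EdgeMinimal)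
open Summit.PneNP.PneNP.Theorems.PstarGraphQuadGapInstance
open Summit.PneNP.PneNP.Theorems.PstarGraphQuadGapReduction (idxSet liftSet lift liftW minInfeasible_univ)
open Summit.PneNP.PneNP.Theorems.PstarGapCluster (maxDegree_inst_sharp)
open Summit.PneNP.PneNP.Theorems.PstarPinGap (UnitPins)

namespace Summit.PneNP.PneNP.Theorems.PstarMixedPinStar

/-! ## The star system -/

section Star

variable (Δ h : ℕ)

/-- Centre `q_k` of the `k`-th star. -/
def centre (k : Fin h) : Fin (h + h * Δ) := Fin.castAdd (h * Δ) k

/-- Leaf `c_{k,i}` of the `k`-th star. -/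
def leafV (ki : Fin h × Fin Δ) : Fin (h + h * Δ) := Fin.natAdd h (finProdFinEquiv ki)

/-- The edge `(q_k, c_{k,i})`. -/
def sedge (ki : Fin h × Fin Δ) : Edge (h + h * Δ) := (centre Δ h ki.1, leafV Δ h ki)

/-- `h` disjoint stars `K_{1,Δ}`. -/
def stars : Finset (Edge (h + h * Δ)) := (univ : Finset (Fin h × Fin Δ)).image (sedge Δ h)

/-- The quadratic constraint `Σ_E a_p a_q = 1` (in the lifted instance: the parity of all tips). -/
def quad : QCon (h + h * Δ) := (stars Δ h, ∅, true)

/-- The pin `a_{q_k} = 0`. -/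
def pin (k : Fin h) : QCon (h + h * Δ) := (∅, {centre Δ h k}, false)

/-- The pins. -/
def pins : Finset (QCon (h + h * Δ)) := (univ : Finset (Fin h)).image (pin Δ h)

/-- Value of a centre. -/
theorem centre_val (k : Fin h) : (centre Δ h k).val = k.val := rfl

/-- Value of a leaf. -/
theorem leafV_val (ki : Fin h × Fin Δ) : (leafV Δ h ki).val = h + (finProdFinEquiv ki).val := rfl

/-- `sedge` is injective. -/
theorem sedge_injective : Function.Injective (sedge Δ h) := by
  intro ki ki' he
  have h2 : leafV Δ h ki = leafV Δ h ki' := congrArg Prod.snd he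
  unfold leafV at h2
  exact finProdFinEquiv.injective (Fin.natAdd_injective _ _ h2)

/-- `h·Δ` edges. -/
theorem card_stars : (stars Δ h).card = h * Δ := by
  rw [stars, card_image_of_injective _ (sedge_injective Δ h), card_univ, Fintype.card_prod, Fintype.card_fin, Fintype.card_fin]

/-- The stars form a simple graph (centre index `<` leaf index). -/
theorem simple_stars : Simple (stars Δ h) := by
  intro e he
  obtain ⟨ki, -, rfl⟩ := mem_image.1 he
  show centre Δ h ki.1 < leafV Δ h ki
  rw [Fin.lt_def, centre_val, leafV_val]
  have := ki.1.isLt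
  omega

/-- Maximum degree `Δ` (for `Δ ≥ 1`). -/
theorem edgeMaxDegree_stars (hΔ : 1 ≤ Δ) : EdgeMaxDegree Δ (stars Δ h) := by
  classical
  intro v
  by_cases hv : v.val < h
  · -- a centre: its edges are the `Δ` edges of its star
    have hsub : (stars Δ h).filter (fun e => e.1 = v ∨ e.2 = v) ⊆
        (univ : Finset (Fin Δ)).image fun i => sedge Δ h (⟨v.val, hv⟩, i) := by
      intro e he
      obtain ⟨he, hve⟩ := mem_filter.1 he
      obtain ⟨ki, -, rfl⟩ := mem_image.1 he
      rcases hve with h1 | h1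
      · have hk : ki.1 = ⟨v.val, hv⟩ := by
          apply Fin.ext
          have := congrArg Fin.val h1
          rw [sedge, centre_val] at this
          exact this
        refine mem_image.2 ⟨ki.2, mem_univ _, ?_⟩
        rw [← hk]
      · exfalso
        have := congrArg Fin.val h1
        simp only [sedge, leafV_val] at this
        omega
    exact (card_le_card hsub).trans (card_image_le.trans (by rw [card_univ, Fintype.card_fin]))
  · -- a leaf (or out of range): at most one edge
    have h1 : ((stars Δ h).filter fun e => e.1 = v ∨ e.2 = v).card ≤ 1 := by
      refine card_le_one.2 fun e he e' he' => ?_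
      obtain ⟨he, hve⟩ := mem_filter.1 he
      obtain ⟨he', hve'⟩ := mem_filter.1 he'
      obtain ⟨ki, -, rfl⟩ := mem_image.1 he
      obtain ⟨ki', -, rfl⟩ := mem_image.1 he'
      have hc : ∀ ki₀ : Fin h × Fin Δ, (sedge Δ h ki₀).1 ≠ v := fun ki₀ heq => by
        have := congrArg Fin.val heq
        rw [sedge, centre_val] at this
        have := ki₀.1.isLt
        omega
      have e1 : leafV Δ h ki = v := (hve.resolve_left (hc ki))
      have e2 : leafV Δ h ki' = v := (hve'.resolve_left (hc ki'))
      have : ki = ki' := by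
        unfold leafV at e1 e2
        exact finProdFinEquiv.injective (Fin.natAdd_injective _ _ (e1.trans e2.symm))
      rw [this]
    omega

/-- The quadratic constraint is not a pin. -/
theorem quad_notMem_pins : quad Δ h ∉ pins Δ h := by
  intro hq
  obtain ⟨k, -, hk⟩ := mem_image.1 hq
  have := congrArg (fun w : QCon (h + h * Δ) => w.2.2) hk
  simp [quad, pin] at this

/-- At most `h` pins. -/
theorem card_pins_le : (pins Δ h).card ≤ h :=
  card_image_le.trans (by rw [card_univ, Fintype.card_fin])

/-- Supported. -/
theorem supported_system : Supported (stars Δ h) (insert (quad Δ h) (pins Δ h)) := by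
  intro w hw
  rcases mem_insert.1 hw with rfl | hw
  · exact Subset.rfl
  · obtain ⟨k, -, rfl⟩ := mem_image.1 hw
    exact empty_subset _

/-- A pin holds iff its centre is `false`. -/
theorem qholds_pin_iff (k : Fin h) (a : Fin (h + h * Δ) → Bool) : QHolds (pin Δ h k) a ↔ a (centre Δ h k) = false := by
  unfold PstarGraphQuadGap.QHolds PstarGraphQuadGap.qval PstarPDT.parity pin
  simp only [filter_empty, card_empty, Nat.not_odd_zero, decide_false, Bool.false_xor]
  rw [show (({centre Δ h k} : Finset _).filter fun v => a v = true) =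
      if a (centre Δ h k) = true then {centre Δ h k} else ∅ from by
    split_ifs with hc
    · ext v; simp only [mem_filter, mem_singleton]; exact ⟨fun h => h.1, fun h => ⟨h, h ▸ hc⟩⟩
    · ext v; simp only [mem_filter, mem_singleton, notMem_empty, iff_false, not_and]; exact fun hv => hv ▸ hc]
  cases a (centre Δ h k) <;> simp

/-- The quadratic constraint holds iff oddly many star edges are on. -/
theorem qholds_quad_iff (a : Fin (h + h * Δ) → Bool) :
    QHolds (quad Δ h) a ↔ Odd ((stars Δ h).filter fun e => a e.1 = true ∧ a e.2 = true).card := by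
  unfold PstarGraphQuadGap.QHolds PstarGraphQuadGap.qval quad
  simp [PstarPDT.parity]

/-- **Unsat**: the pins kill every monomial. -/
theorem unsat_system : Unsat (insert (quad Δ h) (pins Δ h)) := by
  classical
  rintro ⟨a, ha⟩
  have hpins : ∀ k, a (centre Δ h k) = false := fun k =>
    (qholds_pin_iff Δ h k a).1 (ha _ (mem_insert_of_mem (mem_image_of_mem _ (mem_univ k))))
  have hq := (qholds_quad_iff Δ h a).1 (ha _ (mem_insert_self _ _))
  have h0 : ((stars Δ h).filter fun e => a e.1 = true ∧ a e.2 = true) = ∅ := by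
    refine eq_empty_of_forall_notMem fun e he => ?_
    obtain ⟨he, h1, -⟩ := mem_filter.1 he
    obtain ⟨ki, -, rfl⟩ := mem_image.1 he
    have : a (centre Δ h ki.1) = true := h1
    rw [hpins] at this
    exact Bool.false_ne_true this
  rw [h0, card_empty] at hq
  exact Nat.not_odd_zero hq

/-- **Edge-minimal**: the all-`false` assignment satisfies exactly the pins. -/
theorem edgeMinimal_system : EdgeMinimal (stars Δ h) (insert (quad Δ h) (pins Δ h)) := by
  classical
  intro e he
  refine ⟨fun _ => false, fun w hw => ?_⟩
  rcases mem_insert.1 hw with rfl | hw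
  · rw [qholds_quad_iff, filter_false_of_mem (fun e _ => by simp), card_empty]
    simp only [Nat.not_odd_zero, false_iff, not_not]
    exact he
  · obtain ⟨k, -, rfl⟩ := mem_image.1 hw
    rw [qholds_pin_iff]
    simp [pin]

end Star

/-! ## The lifted instance -/

/-- The lift of a pin is the unit pin on the centre's AND variable. -/
theorem liftSet_pin {V : ℕ} (E : Finset (Edge V)) (q : Fin V) :
    liftSet E ((∅ : Finset (Edge V)), ({q} : Finset (Fin V)), false) = {av E q} := by
  classical
  unfold PstarGraphQuadGapReduction.liftSet PstarGraphQuadGapReduction.idxSet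
  rw [filter_false_of_mem (fun j _ => notMem_empty _), biUnion_empty, empty_union, map_singleton]
  rfl

/-- XOR slots of the instance are never AND variables. -/
theorem vars_xor_ne_av {V : ℕ} (E : Finset (Edge V)) (j : Fin E.card) (s : Fin 4) (hs : s.val < 2) (q : Fin V) :
    (inst E).vars j s ≠ av E q := by
  have h01 : s = 0 ∨ s = 1 := by fin_cases s <;> simp at hs ⊢
  intro heq
  have hv := congrArg Fin.val heq
  rcases h01 with rfl | rfl
  · rw [vars_zero, xv_val, av_val] at hv; have := j.isLt; omega
  · rw [vars_one, xv'_val, av_val] at hv; have := j.isLt; omega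

/-- **The killed-stars family.**  For `Δ ≥ 1` and every `h` there is a pure typed instance with simple overlaps, maximum degree `Δ`,
boundary-expanding for every radius, with `h` unit pins `W` and one parity `w` such that some minimal infeasible set under
`insert w W` has exactly `h·Δ` outputs. -/
theorem exists_killed_stars {Δ : ℕ} (hΔ : 1 ≤ Δ) (h : ℕ) :
    ∃ (n m : ℕ) (I : LocalMap 4 n m) (y : Fin m → Bool) (W : Finset (Finset (Fin n) × Bool)) (w : Finset (Fin n) × Bool)
      (J : Finset (Fin m)), I.IsPure xorAndPred ∧ Typed I ∧ SimpleOverlap I ∧ MaxDegree Δ I ∧ (∀ r, BoundaryExpanding r I) ∧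
        UnitPins I W ∧ W.card ≤ h ∧ MinInfeasible I y (insert w W) J ∧ J.card = h * Δ := by
  classical
  set E := stars Δ h with hE
  have hmin := minInfeasible_univ (simple_stars Δ h) (supported_system Δ h) (unsat_system Δ h) (edgeMinimal_system Δ h)
  have hlift : liftW E (insert (quad Δ h) (pins Δ h)) = insert (lift E (quad Δ h)) ((pins Δ h).image (lift E)) := by
    unfold PstarGraphQuadGapReduction.liftW
    rw [image_insert]
  rw [hlift] at hmin
  refine ⟨_, _, inst E, fun _ => false, (pins Δ h).image (lift E), lift E (quad Δ h), univ, isPure_inst (simple_stars Δ h),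
    typed_inst, simpleOverlap_inst (simple_stars Δ h), maxDegree_inst_sharp E hΔ (edgeMaxDegree_stars Δ h hΔ), boundaryExpanding_inst,
    ?_, card_image_le.trans (card_pins_le Δ h), hmin, ?_⟩
  · -- unit pins on AND variables
    intro e he
    obtain ⟨w, hw, rfl⟩ := mem_image.1 he
    obtain ⟨k, -, rfl⟩ := mem_image.1 hw
    refine ⟨av E (centre Δ h k), ?_, fun j s hs => vars_xor_ne_av E j s hs _⟩
    unfold PstarGraphQuadGapReduction.lift pin
    exact liftSet_pin E _
  · rw [card_univ, Fintype.card_fin, hE, card_stars]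

/-- **T24.21 is multiplicative**: any constant `K` valid in `MixedPinGap` at degree `Δ ≥ 1` satisfies `Δ·h ≤ K·(h+1)` for every `h`. -/
theorem mixedPinGap_const_ge {Δ : ℕ} (hΔ : 1 ≤ Δ) (K : ℕ)
    (hK : ∀ (n m r : ℕ) (I : LocalMap 4 n m), I.IsPure xorAndPred → Typed I → BoundaryExpanding r I → SimpleOverlap I →
      MaxDegree Δ I → ∀ (y : Fin m → Bool) (W : Finset (Finset (Fin n) × Bool)) (w : Finset (Fin n) × Bool) (J : Finset (Fin m)),
        UnitPins I W → J.card ≤ r → MinInfeasible I y (insert w W) J → J.card ≤ K * (W.card + 1))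
    (h : ℕ) : Δ * h ≤ K * (h + 1) := by
  obtain ⟨n, m, I, y, W, w, J, hI, hT, hS, hD, hB, hU, hW, hmin, hJ⟩ := exists_killed_stars hΔ h
  have h1 := hK n m J.card I hI hT (hB _) hS hD y W w J hU le_rfl hmin
  rw [hJ] at h1
  calc Δ * h = h * Δ := Nat.mul_comm _ _
    _ ≤ K * (W.card + 1) := h1
    _ ≤ K * (h + 1) := Nat.mul_le_mul_left K (Nat.add_le_add_right hW 1)

end Summit.PneNP.PneNP.Theorems.PstarMixedPinStar
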